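import Mathlib
import Literature.MathematicalPhysics.MHD.SolovevFluxSurfaceGGJDerivs
import HarnessLib

/-!
# The safety-factor PROFILE of the Lee–Cerfon / CHEASE Solov'ev family is strictly increasing outward and
# exceeds its on-axis value on every flux surface (proved; no numerics)

Lee–Cerfon, Comput. Phys. Commun. 190 (2015) §4.1 (bib `LeeCerfon2015`) print the exact safety factor of the
Solov'ev solution (solo2) on the surface of minor-radius label `r`, their (q4); in the tree this is
`safetyFactorE_lcLoop` (Freidberg's functional (6.35) on the printed loop, `SolovevFluxSurfaceLoop.lean`,
gridfusion-model-5): `q(r) = (q₀R₀³/π)∫₀^π u(t)^{-3/2} dt`, `u(t) = R₀² + 2rR₀cos t`, `0 < r < R₀/2`, and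
`hasDerivAt_safetyFactorE_lcLoop` (`SolovevFluxSurfaceGGJDerivs.lean`): `dq/dr = (q₀R₀³/π)∫₀^π lcQKernelDr`,
`lcQKernelDr = −3R₀cos t/(u²√u)`.

THIS FILE proves two ELEMENTARY, numerics-free facts about that printed profile, by the reflection `t ↦ π − t`
(`u(π − t) = 2R₀² − u(t)`):
* `q0_lt_safetyFactorE_lcLoop` — **`q(r) > q₀` on every surface `0 < r < R₀/2`**: the tangent-line
  (supporting-line) inequality of the strictly convex `x ↦ x^{-3/2}` at `x = R₀²` gives
  `u(t)^{-3/2} + u(π−t)^{-3/2} ≥ 2R₀^{-3}` pointwise, strictly at `t = 0`, hence `∫₀^π u^{-3/2} > π/R₀³`;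
* `integral_lcQKernelDr_pos`, `deriv_safetyFactorE_lcLoop_pos`, **`strictMonoOn_safetyFactorE_lcLoop`** —
  **positive magnetic shear**: `lcQKernelDr(t) + lcQKernelDr(π−t) = 3R₀cos t·(u(π−t)^{-5/2} − u(t)^{-5/2}) ≥ 0`
  with strict inequality on `(0, π/2)`, so `dq/dr > 0` and `r ↦ q(r)` is strictly increasing on `(0, R₀/2)`.
Consequence used Summits-side (LADDER-GRIDFUSION F1, cell gridfusion, seat sos-6 g3): with the certified
on-axis statement `q₀(F) ≥ 1` (`Models/SolovevPCF`, `q0_ge_one`) the Kruskal–Shafranov-type inequality `q > 1`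
holds on EVERY flux surface of the typed PCF equilibria, F-parametrically — a whole-profile statement.
HONEST FRAMING: exact real analysis about MODEL objects (ideal MHD, Solov'ev profiles, analytic fixed
boundary); nothing here says anything is stable. Prover: gridfusion-sos-6 (g3), 2026-08-27.
-/

noncomputable section

namespace Literature.MathematicalPhysics.MHD.Solovev

open GradShafranov _root_.Real MeasureTheory intervalIntegral _root_.Set

/-! ## The supporting line of `x ↦ x^{-3/2}` -/

/-- Tangent-line inequality of the convex `x ↦ (x√x)⁻¹ = x^{-3/2}` at `a > 0`:
`(x√x)⁻¹ ≥ (a√a)⁻¹ − (3/2)(x − a)/(a²√a)` for `x > 0` (with `x = s²`, `a = b²` it is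
`3s⁵ − 5b²s³ + 2b⁵ = (s − b)²(3s³ + 6bs² + 4b²s + 2b³) ≥ 0`). [folklore] -/
private theorem inv32_tangent_le {x a : ℝ} (hx : 0 < x) (ha : 0 < a) :
    1 / (a * Real.sqrt a) - 3 / 2 * (x - a) / (a ^ 2 * Real.sqrt a) ≤ (x * Real.sqrt x)⁻¹ := by
  set s := Real.sqrt x with hs_def
  set b := Real.sqrt a with hb_def
  have hs : 0 < s := Real.sqrt_pos.2 hx
  have hb : 0 < b := Real.sqrt_pos.2 ha
  have hx' : x = s ^ 2 := by rw [hs_def, Real.sq_sqrt hx.le]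
  have ha' : a = b ^ 2 := by rw [hb_def, Real.sq_sqrt ha.le]
  rw [hx', ha']
  have key : (s ^ 2 * s)⁻¹ - (1 / (b ^ 2 * b) - 3 / 2 * (s ^ 2 - b ^ 2) / ((b ^ 2) ^ 2 * b))
      = (s - b) ^ 2 * (3 * s ^ 3 + 6 * b * s ^ 2 + 4 * b ^ 2 * s + 2 * b ^ 3) / (2 * s ^ 3 * b ^ 5) := by
    field_simp
    ring
  rw [← sub_nonneg, key]
  positivity

/-- Strict form of `inv32_tangent_le` for `x ≠ a`. [folklore] -/
private theorem inv32_tangent_lt {x a : ℝ} (hx : 0 < x) (ha : 0 < a) (hne : x ≠ a) :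
    1 / (a * Real.sqrt a) - 3 / 2 * (x - a) / (a ^ 2 * Real.sqrt a) < (x * Real.sqrt x)⁻¹ := by
  set s := Real.sqrt x with hs_def
  set b := Real.sqrt a with hb_def
  have hs : 0 < s := Real.sqrt_pos.2 hx
  have hb : 0 < b := Real.sqrt_pos.2 ha
  have hx' : x = s ^ 2 := by rw [hs_def, Real.sq_sqrt hx.le]
  have ha' : a = b ^ 2 := by rw [hb_def, Real.sq_sqrt ha.le]
  have hsb : s - b ≠ 0 := by
    intro h
    apply hne
    rw [hx', ha', sub_eq_zero.1 h]
  rw [hx', ha']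
  have key : (s ^ 2 * s)⁻¹ - (1 / (b ^ 2 * b) - 3 / 2 * (s ^ 2 - b ^ 2) / ((b ^ 2) ^ 2 * b))
      = (s - b) ^ 2 * (3 * s ^ 3 + 6 * b * s ^ 2 + 4 * b ^ 2 * s + 2 * b ^ 3) / (2 * s ^ 3 * b ^ 5) := by
    field_simp
    ring
  rw [← sub_pos, key]
  exact div_pos (mul_pos (sq_pos_of_ne_zero hsb) (by positivity)) (by positivity)

/-! ## The reflection `t ↦ π − t` on the printed loop -/

/-- `u(π − t) = 2R₀² − u(t)` (`cos(π − t) = −cos t`). [cite: LeeCerfon2015, §4.1 (boundary parametrisation)] -/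
theorem lcU_pi_sub (R₀ r t : ℝ) : lcU R₀ r (π - t) = 2 * R₀ ^ 2 - lcU R₀ r t := by
  unfold lcU; rw [Real.cos_pi_sub]; ring

/-- Pointwise lower bound of the reflected pair: `u(t)^{-3/2} + u(π−t)^{-3/2} ≥ 2/R₀³`
(`0 ≤ r`, `2r < R₀`). [cite: LeeCerfon2015, §4.1 eq. (q4)] -/
theorem two_div_le_lcU_inv32_pair {R₀ r : ℝ} (hR₀ : 0 < R₀) (hr : 0 ≤ r) (h2r : 2 * r < R₀) (t : ℝ) :
    2 / R₀ ^ 3 ≤ (lcU R₀ r t * Real.sqrt (lcU R₀ r t))⁻¹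
      + (lcU R₀ r (π - t) * Real.sqrt (lcU R₀ r (π - t)))⁻¹ := by
  have ha : 0 < R₀ ^ 2 := by positivity
  have h1 := inv32_tangent_le (lcU_pos hR₀ hr h2r t) ha
  have h2 := inv32_tangent_le (lcU_pos hR₀ hr h2r (π - t)) ha
  have hsq : Real.sqrt (R₀ ^ 2) = R₀ := Real.sqrt_sq hR₀.le
  rw [hsq] at h1 h2
  rw [lcU_pi_sub] at h2 ⊢
  have e : 1 / (R₀ ^ 2 * R₀) - 3 / 2 * (lcU R₀ r t - R₀ ^ 2) / ((R₀ ^ 2) ^ 2 * R₀)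
      + (1 / (R₀ ^ 2 * R₀) - 3 / 2 * (2 * R₀ ^ 2 - lcU R₀ r t - R₀ ^ 2) / ((R₀ ^ 2) ^ 2 * R₀))
      = 2 / R₀ ^ 3 := by
    field_simp
    ring
  linarith

/-- At `t = 0` the pair inequality is strict when `r > 0` (`u(0) = R₀² + 2rR₀ ≠ R₀²`).
[cite: LeeCerfon2015, §4.1 eq. (q4)] -/
theorem two_div_lt_lcU_inv32_pair_zero {R₀ r : ℝ} (hR₀ : 0 < R₀) (hr : 0 < r) (h2r : 2 * r < R₀) :
    2 / R₀ ^ 3 < (lcU R₀ r 0 * Real.sqrt (lcU R₀ r 0))⁻¹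
      + (lcU R₀ r (π - 0) * Real.sqrt (lcU R₀ r (π - 0)))⁻¹ := by
  have ha : 0 < R₀ ^ 2 := by positivity
  have hne : lcU R₀ r 0 ≠ R₀ ^ 2 := by
    unfold lcU; rw [Real.cos_zero]; nlinarith
  have h1 := inv32_tangent_lt (lcU_pos hR₀ hr.le h2r 0) ha hne
  have h2 := inv32_tangent_le (lcU_pos hR₀ hr.le h2r (π - 0)) ha
  have hsq : Real.sqrt (R₀ ^ 2) = R₀ := Real.sqrt_sq hR₀.le
  rw [hsq] at h1 h2
  rw [lcU_pi_sub] at h2 ⊢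
  have e : 1 / (R₀ ^ 2 * R₀) - 3 / 2 * (lcU R₀ r 0 - R₀ ^ 2) / ((R₀ ^ 2) ^ 2 * R₀)
      + (1 / (R₀ ^ 2 * R₀) - 3 / 2 * (2 * R₀ ^ 2 - lcU R₀ r 0 - R₀ ^ 2) / ((R₀ ^ 2) ^ 2 * R₀))
      = 2 / R₀ ^ 3 := by
    field_simp
    ring
  linarith

/-- Continuity of `t ↦ (u√u)⁻¹` on a regular surface. [cite: LeeCerfon2015, §4.1 eq. (q4)] -/
theorem continuous_lcU_inv32' {R₀ r : ℝ} (hR₀ : 0 < R₀) (hr : 0 ≤ r) (h2r : 2 * r < R₀) :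
    Continuous fun t => (lcU R₀ r t * Real.sqrt (lcU R₀ r t))⁻¹ := by
  have hc : Continuous (lcU R₀ r) := by unfold lcU; fun_prop
  exact (hc.mul hc.sqrt).fun_inv₀ fun t =>
    (mul_pos (lcU_pos hR₀ hr h2r t) (Real.sqrt_pos.2 (lcU_pos hR₀ hr h2r t))).ne'

/-- **`∫₀^π u^{-3/2} dt > π/R₀³` on every surface `0 < r < R₀/2`** (reflection + the supporting line of
`x^{-3/2}`; equality would need `r = 0`). [cite: LeeCerfon2015, §4.1 eq. (q4)] -/
theorem pi_div_lt_integral_lcU_inv32 {R₀ r : ℝ} (hR₀ : 0 < R₀) (hr : 0 < r) (h2r : 2 * r < R₀) :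
    π / R₀ ^ 3 < ∫ t in (0 : ℝ)..π, (lcU R₀ r t * Real.sqrt (lcU R₀ r t))⁻¹ := by
  have hc := continuous_lcU_inv32' hR₀ hr.le h2r
  have hc' : Continuous fun t => (lcU R₀ r (π - t) * Real.sqrt (lcU R₀ r (π - t)))⁻¹ :=
    hc.comp (continuous_const.sub continuous_id)
  have hrefl : ∫ t in (0 : ℝ)..π, (lcU R₀ r (π - t) * Real.sqrt (lcU R₀ r (π - t)))⁻¹
      = ∫ t in (0 : ℝ)..π, (lcU R₀ r t * Real.sqrt (lcU R₀ r t))⁻¹ := by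
    rw [intervalIntegral.integral_comp_sub_left (fun t => (lcU R₀ r t * Real.sqrt (lcU R₀ r t))⁻¹) π,
      sub_self, sub_zero]
  have hsum : ∫ t in (0 : ℝ)..π, ((lcU R₀ r t * Real.sqrt (lcU R₀ r t))⁻¹
        + (lcU R₀ r (π - t) * Real.sqrt (lcU R₀ r (π - t)))⁻¹)
      = 2 * ∫ t in (0 : ℝ)..π, (lcU R₀ r t * Real.sqrt (lcU R₀ r t))⁻¹ := by
    rw [intervalIntegral.integral_add (hc.intervalIntegrable _ _) (hc'.intervalIntegrable _ _), hrefl]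
    ring
  have hlt : ∫ t in (0 : ℝ)..π, (2 / R₀ ^ 3 : ℝ)
      < ∫ t in (0 : ℝ)..π, ((lcU R₀ r t * Real.sqrt (lcU R₀ r t))⁻¹
        + (lcU R₀ r (π - t) * Real.sqrt (lcU R₀ r (π - t)))⁻¹) := by
    refine intervalIntegral.integral_lt_integral_of_continuousOn_of_le_of_exists_lt Real.pi_pos
      continuousOn_const ((hc.add hc').continuousOn)
      (fun t _ => two_div_le_lcU_inv32_pair hR₀ hr.le h2r t)
      ⟨0, ⟨le_refl 0, Real.pi_pos.le⟩, two_div_lt_lcU_inv32_pair_zero hR₀ hr h2r⟩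
  rw [intervalIntegral.integral_const, hsum] at hlt
  simp only [sub_zero, smul_eq_mul] at hlt
  rw [show π * (2 / R₀ ^ 3) = π / R₀ ^ 3 * 2 by ring] at hlt
  linarith

/-- **`q(r) > q₀` on every flux surface** of the Lee–Cerfon family: Freidberg's safety factor (6.35) on the
printed loop of label `0 < r < R₀/2` strictly exceeds the on-axis value `q₀`. [cite: LeeCerfon2015, §4.1 eq. (q4)] -/
theorem q0_lt_safetyFactorE_lcLoop {R₀ κ FB q₀ r : ℝ} (hR₀ : 0 < R₀) (hκ : 0 < κ) (hFB : 0 < FB)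
    (hq₀ : 0 < q₀) (hr : 0 < r) (h2r : 2 * r < R₀) (a : ℝ) :
    q₀ < safetyFactorE FB (psiLC κ FB R₀ q₀ a) (lcLoop R₀ κ r) (2 * π) := by
  rw [safetyFactorE_lcLoop hR₀ hκ hFB hq₀ hr h2r a]
  have h := pi_div_lt_integral_lcU_inv32 hR₀ hr h2r
  have hR3 : 0 < R₀ ^ 3 := by positivity
  have hπ := Real.pi_pos
  calc q₀ = q₀ * R₀ ^ 3 / π * (π / R₀ ^ 3) := by field_simp
    _ < q₀ * R₀ ^ 3 / π * ∫ t in (0 : ℝ)..π, (lcU R₀ r t * Real.sqrt (lcU R₀ r t))⁻¹ :=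
        mul_lt_mul_of_pos_left h (by positivity)

/-! ## Positive shear -/

/-- Monotonicity of `x ↦ (x²√x)⁻¹`: for `0 < x ≤ y`, `(y²√y)⁻¹ ≤ (x²√x)⁻¹`. [folklore] -/
private theorem inv52_antitone {x y : ℝ} (hx : 0 < x) (hxy : x ≤ y) :
    (y ^ 2 * Real.sqrt y)⁻¹ ≤ (x ^ 2 * Real.sqrt x)⁻¹ := by
  have hsx : 0 < Real.sqrt x := Real.sqrt_pos.2 hx
  apply inv_anti₀ (by positivity)
  gcongr

/-- Strict monotonicity of `x ↦ (x²√x)⁻¹`: for `0 < x < y`, `(y²√y)⁻¹ < (x²√x)⁻¹`. [folklore] -/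
private theorem inv52_strictAnti {x y : ℝ} (hx : 0 < x) (hxy : x < y) :
    (y ^ 2 * Real.sqrt y)⁻¹ < (x ^ 2 * Real.sqrt x)⁻¹ := by
  have hsx : 0 < Real.sqrt x := Real.sqrt_pos.2 hx
  apply inv_strictAnti₀ (by positivity)
  gcongr

/-- The reflected pair of the shear kernel: `lcQKernelDr(t) + lcQKernelDr(π−t)
= 3R₀cos t·((u(π−t)²√u(π−t))⁻¹ − (u(t)²√u(t))⁻¹)`. [cite: LeeCerfon2015, §4.1 eq. (q4)] -/
theorem lcQKernelDr_pair (R₀ r t : ℝ) :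
    lcQKernelDr R₀ r t + lcQKernelDr R₀ r (π - t)
      = 3 * (R₀ * Real.cos t) * ((lcU R₀ r (π - t) ^ 2 * Real.sqrt (lcU R₀ r (π - t)))⁻¹
          - (lcU R₀ r t ^ 2 * Real.sqrt (lcU R₀ r t))⁻¹) := by
  unfold lcQKernelDr
  rw [Real.cos_pi_sub]
  ring

/-- The reflected pair of the shear kernel is nonnegative on every regular surface (`0 ≤ r`, `2r < R₀`).
[cite: LeeCerfon2015, §4.1 eq. (q4)] -/
theorem lcQKernelDr_pair_nonneg {R₀ r : ℝ} (hR₀ : 0 < R₀) (hr : 0 ≤ r) (h2r : 2 * r < R₀) (t : ℝ) :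
    0 ≤ lcQKernelDr R₀ r t + lcQKernelDr R₀ r (π - t) := by
  rw [lcQKernelDr_pair]
  have hu := lcU_pos hR₀ hr h2r t
  have hu' := lcU_pos hR₀ hr h2r (π - t)
  have hdiff : lcU R₀ r t - lcU R₀ r (π - t) = 4 * r * R₀ * Real.cos t := by
    rw [lcU_pi_sub]; unfold lcU; ring
  rcases le_or_gt 0 (Real.cos t) with hc | hc
  · have hle : lcU R₀ r (π - t) ≤ lcU R₀ r t := by nlinarith [mul_nonneg (mul_nonneg hr hR₀.le) hc]
    exact mul_nonneg (by positivity) (sub_nonneg.2 (inv52_antitone hu' hle))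
  · have hle : lcU R₀ r t ≤ lcU R₀ r (π - t) := by nlinarith [mul_nonneg (mul_nonneg hr hR₀.le) (neg_nonneg.2 hc.le)]
    exact mul_nonneg_of_nonpos_of_nonpos (by nlinarith) (sub_nonpos.2 (inv52_antitone hu hle))

/-- On `(0, π/2)` the reflected pair of the shear kernel is strictly positive when `r > 0`.
[cite: LeeCerfon2015, §4.1 eq. (q4)] -/
theorem lcQKernelDr_pair_pos {R₀ r : ℝ} (hR₀ : 0 < R₀) (hr : 0 < r) (h2r : 2 * r < R₀) {t : ℝ}
    (ht : t ∈ Ioo 0 (π / 2)) : 0 < lcQKernelDr R₀ r t + lcQKernelDr R₀ r (π - t) := by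
  rw [lcQKernelDr_pair]
  have hu' := lcU_pos hR₀ hr.le h2r (π - t)
  have hc : 0 < Real.cos t := Real.cos_pos_of_mem_Ioo ⟨by linarith [ht.1, Real.pi_pos], ht.2⟩
  have hdiff : lcU R₀ r t - lcU R₀ r (π - t) = 4 * r * R₀ * Real.cos t := by
    rw [lcU_pi_sub]; unfold lcU; ring
  have hlt : lcU R₀ r (π - t) < lcU R₀ r t := by nlinarith [mul_pos (mul_pos hr hR₀) hc]
  exact mul_pos (by positivity) (sub_pos.2 (inv52_strictAnti hu' hlt))

/-- Continuity of the shear kernel on a regular surface. [cite: LeeCerfon2015, §4.1 eq. (q4)] -/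
theorem continuous_lcQKernelDr {R₀ r : ℝ} (hR₀ : 0 < R₀) (hr : 0 ≤ r) (h2r : 2 * r < R₀) :
    Continuous (lcQKernelDr R₀ r) := by
  have hc : Continuous (lcU R₀ r) := by unfold lcU; fun_prop
  have e : lcQKernelDr R₀ r = fun t => -(3 * (R₀ * Real.cos t))
      / (lcU R₀ r t ^ 2 * Real.sqrt (lcU R₀ r t)) := by funext t; rfl
  rw [e]
  have h1 : Continuous fun t => -(3 * (R₀ * Real.cos t)) := by fun_prop
  have h2 : Continuous fun t => lcU R₀ r t ^ 2 * Real.sqrt (lcU R₀ r t) := (hc.pow 2).mul hc.sqrt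
  exact h1.div₀ h2 fun t =>
    (mul_pos (pow_pos (lcU_pos hR₀ hr h2r t) 2) (Real.sqrt_pos.2 (lcU_pos hR₀ hr h2r t))).ne'

/-- **`∫₀^π lcQKernelDr dt > 0`** on every surface `0 < r < R₀/2` (reflection: the integral is half the
integral of the nonnegative reflected pair, which is positive on `(0, π/2)`). [cite: LeeCerfon2015, §4.1 eq. (q4)] -/
theorem integral_lcQKernelDr_pos {R₀ r : ℝ} (hR₀ : 0 < R₀) (hr : 0 < r) (h2r : 2 * r < R₀) :
    0 < ∫ t in (0 : ℝ)..π, lcQKernelDr R₀ r t := by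
  have hc := continuous_lcQKernelDr hR₀ hr.le h2r
  have hc' : Continuous fun t => lcQKernelDr R₀ r (π - t) := hc.comp (continuous_const.sub continuous_id)
  have hrefl : ∫ t in (0 : ℝ)..π, lcQKernelDr R₀ r (π - t) = ∫ t in (0 : ℝ)..π, lcQKernelDr R₀ r t := by
    rw [intervalIntegral.integral_comp_sub_left (fun t => lcQKernelDr R₀ r t) π, sub_self, sub_zero]
  have hsum : ∫ t in (0 : ℝ)..π, (lcQKernelDr R₀ r t + lcQKernelDr R₀ r (π - t))
      = 2 * ∫ t in (0 : ℝ)..π, lcQKernelDr R₀ r t := by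
    rw [intervalIntegral.integral_add (hc.intervalIntegrable _ _) (hc'.intervalIntegrable _ _), hrefl]
    ring
  have hlt : ∫ t in (0 : ℝ)..π, (0 : ℝ)
      < ∫ t in (0 : ℝ)..π, (lcQKernelDr R₀ r t + lcQKernelDr R₀ r (π - t)) := by
    refine intervalIntegral.integral_lt_integral_of_continuousOn_of_le_of_exists_lt Real.pi_pos
      continuousOn_const ((hc.add hc').continuousOn)
      (fun t _ => lcQKernelDr_pair_nonneg hR₀ hr.le h2r t)
      ⟨π / 4, ⟨by positivity, by linarith [Real.pi_pos]⟩,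
        lcQKernelDr_pair_pos hR₀ hr h2r ⟨by positivity, by linarith [Real.pi_pos]⟩⟩
  rw [intervalIntegral.integral_const, hsum] at hlt
  simp only [smul_zero] at hlt
  linarith

/-- **Positive shear, derivative form:** `d/dr q(r) > 0` on every surface `0 < r < R₀/2`.
[cite: LeeCerfon2015, §4.1 eq. (q4)] -/
theorem deriv_safetyFactorE_lcLoop_pos {R₀ κ FB q₀ r : ℝ} (hR₀ : 0 < R₀) (hκ : 0 < κ) (hFB : 0 < FB)
    (hq₀ : 0 < q₀) (hr : 0 < r) (h2r : 2 * r < R₀) (a : ℝ) :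
    0 < deriv (fun ρ => safetyFactorE FB (psiLC κ FB R₀ q₀ a) (lcLoop R₀ κ ρ) (2 * π)) r := by
  rw [(hasDerivAt_safetyFactorE_lcLoop hR₀ hκ hFB hq₀ hr h2r a).2.deriv]
  exact mul_pos (by positivity) (integral_lcQKernelDr_pos hR₀ hr h2r)

/-- **Positive shear: the safety-factor profile is strictly increasing in the surface label** on
`(0, R₀/2)` — for `0 < r₁ < r₂ < R₀/2`, `q(r₁) < q(r₂)`. [cite: LeeCerfon2015, §4.1 eq. (q4)] -/
theorem strictMonoOn_safetyFactorE_lcLoop {R₀ κ FB q₀ : ℝ} (hR₀ : 0 < R₀) (hκ : 0 < κ) (hFB : 0 < FB)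
    (hq₀ : 0 < q₀) (a : ℝ) :
    StrictMonoOn (fun ρ => safetyFactorE FB (psiLC κ FB R₀ q₀ a) (lcLoop R₀ κ ρ) (2 * π)) (Ioo 0 (R₀ / 2)) := by
  refine strictMonoOn_of_deriv_pos (convex_Ioo 0 (R₀ / 2)) ?_ ?_
  · intro x hx
    exact (hasDerivAt_safetyFactorE_lcLoop hR₀ hκ hFB hq₀ hx.1 (by linarith [hx.2]) a).2
      |>.continuousAt.continuousWithinAt
  · intro x hx
    rw [interior_Ioo] at hx
    exact deriv_safetyFactorE_lcLoop_pos hR₀ hκ hFB hq₀ hx.1 (by linarith [hx.2]) a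

end Literature.MathematicalPhysics.MHD.Solovev

end
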